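import Summits.BirchSwinnertonDyer.BirchSwinnertonDyer.Theorems.ManinLocalTwoThreeEvenManinKummerSquare
import Summits.BirchSwinnertonDyer.BirchSwinnertonDyer.Theorems.ManinLocalTwoThreeSquareRootDescent
import Summits.BirchSwinnertonDyer.BirchSwinnertonDyer.Theorems.ManinLocalTwoThreeManinThreeKummerCubeArith
import Literature.NumberTheory.EllipticCurves.KuriharaNumber
import Mathlib.RingTheory.PowerSeries.Ideal
import Mathlib.RingTheory.PowerSeries.Binomial
import Mathlib.RingTheory.UniqueFactorizationDomain.Multiplicity
import HarnessLib

/-!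
# (BI₂) — `4 ∣ N`, `2 ∣ c` make the normalised SQUARE ROOT of the Kummer series `Ξ_T` of a rational `2`-torsion point `2`-ADICALLY INTEGRAL
(route `ManinLocalTwoThree`, deciding crux C2 `ManinOddAtFour` stmt-BirchSwinnertonDyer-22967; cell bsd-f2-manin, prover p2 gen 19; LEAD-MEMO v35 §3–§4
«the ℓ = 2 UDC chain»: node (BI₂), the ℓ = 2 port of p3 g15's (BI) `…KummerCubeRootThreeBounded`; `--supports stmt-BirchSwinnertonDyer-22967`)

For a globally minimal `W`, an `X₀(N)`-datum `D` with integral newform coefficients `aₙ`, `4 ∣ N`, a rational root `e` of the `2`-division polynomial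
and THE germ `z` (`log_{E_{W,c}} z = Σ aₙqⁿ/n`, `c = D.c`), put `Ξ_T = kummerSeries W c e z` (`Ξ_T(0) = 1`).
* §1 algebra of formal square roots: uniqueness for a fixed non-zero constant term (`2 ≠ 0`), existence of the rational square root with constant
  term `1` (binomial series `(1+Y)^{1/2}`), `B² ∣ A² ⟹ B ∣ A` in the UFD `ℤ₂⟦q⟧` (Mathlib `UniqueFactorizationMonoid R⟦X⟧` + `pow_dvd_pow_iff_dvd`);
* §2 **`isPadicInt_kummerSeries`** — at `4 ∣ N`, `Ξ_T ∈ ℤ₂⟦q⟧` UNCONDITIONALLY (no `2 ∣ c` needed): `4 ∣ N` ⟹ additive reduction at `2`, `a₁, a₃` even,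
  the plain short model `E♮ = E_{W,1}` is `2`-integral with `a₁ = a₃ = 0`, `exp_{E♮} ∈ ℤ₂⟦T⟧` (p1's `…FormalKummerDoubling` §2), the scaled germ
  `D₂ = c·z = exp_{E♮}(c·L)` (`L = Σ aₙqⁿ/n ∈ ℤ₂⟦q⟧` as `a_{2m} = 0`) is `2`-integral, and `Ξ_T = X_{E♮}(D₂) − e♮·D₂²` with `e♮ = e + b₂/12 ∈ ℤ₂`
  (the §5–§G bookkeeping of the tree proof of E-an-47 `EvenManinKummerSquare_holds`, re-run without the halving);
* §3 **`kummerSqRoot_twoAdicallyIntegral`** — if moreover `2 ∣ c` then `Ξ_T` has a formal square root `h ∈ ℚ⟦q⟧` with `h(0) = 1` ALL OF WHOSE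
  COEFFICIENTS ARE `2`-ADIC INTEGERS (`2 ∤ den hₙ`), and **`kummerSqRoot_unique_twoAdicallyIntegral`**: EVERY `h` with `h² = Ξ_T`, `h(0) = 1` is that
  one.  Proof: E-an-47 (tree theorem) gives `Ξ_T·B² = A²` (`A, B ∈ ℤ₂⟦q⟧`, `B ≠ 0`); with §2, `B² ∣ A²` in the UFD `ℤ₂⟦q⟧`, so `A = B·g`, `g² = Ξ_T`,
  `g(0) = ±1`; `±g` is a square root with constant term `1` in `ℤ₂⟦q⟧`, equal to the image of `h` by uniqueness.  Also the `K`-form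
  **`kummerSqRoot_twoAdicallyBounded`** (`∃ K, ∀ n, 2 ∤ den(2^K hₙ)`, the shape of an's `IsThreeAdicallyBounded` at `2`; here `K = 0`).
HONEST FRAMING.  Node (BI₂) alone — a statement about formal series under the hypothesis `2 ∣ c`, which no optimal curve is known to satisfy; the witness
law (AN2₂), CDT, C2, Manin's conjecture and BSD are NOT proved here.  No definitions, no named facts, no sorry.
[cite: Washington1997, Prop. 7.2–Thm. 7.3 and §7.1 (ℤ_p⟦T⟧ is factorial; here Mathlib's `UniqueFactorizationMonoid R⟦X⟧`)]
[cite: SilvermanAEC2009, IV.1 and IV.5.5 (formal group, log/exp), X.1 Prop. 1.4 (2-descent square; shape, through E-an-47)]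
-/

set_option autoImplicit false
-- lint-debt: the directory name repeats the summit name (sibling precedent `ManinLocalTwoThreeKummerCubeRootThreeBounded.lean`)
set_option linter.dupNamespace false

noncomputable section

open scoped Classical
open PowerSeries

namespace Summit.BirchSwinnertonDyer.BirchSwinnertonDyer.Theorems.ManinLocalTwoThree.KummerSqRootBounded

/-! ## §1 Algebra of formal square roots -/

/-- **Square roots with a fixed non-zero constant term are unique** in `K⟦X⟧` when `K` is a domain with `2 ≠ 0`:
`u² = v²`, `u(0) = v(0) ≠ 0` ⟹ `u = v` (`(u − v)(u + v) = 0` and `u + v` has constant term `2u(0) ≠ 0`). [folklore] -/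
theorem sqRoot_unique {K : Type*} [CommRing K] [IsDomain K] (h2 : (2 : K) ≠ 0) {u v : K⟦X⟧} (huv : u ^ 2 = v ^ 2)
    (h0 : constantCoeff u = constantCoeff v) (hu0 : constantCoeff u ≠ 0) : u = v := by
  have hfac : (u - v) * (u + v) = 0 := by linear_combination huv
  rcases mul_eq_zero.mp hfac with h | h
  · exact sub_eq_zero.mp h
  · exfalso
    have hc := congrArg constantCoeff h
    rw [map_add, ← h0, map_zero, ← two_mul] at hc
    rcases mul_eq_zero.mp hc with h' | h'
    · exact h2 h'
    · exact hu0 h'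

/-- **A rational square root exists for a rational series with constant term `1`**: `h = (1 + Y)^{1/2}` with `Y = Ξ − 1 ∈ Xℚ⟦X⟧`
(binomial series; `binomialSeries_add`). [folklore] -/
theorem exists_sqRoot_of_constantCoeff_eq_one (Ξ : ℚ⟦X⟧) (hΞ : constantCoeff Ξ = 1) :
    ∃ h : ℚ⟦X⟧, h ^ 2 = Ξ ∧ constantCoeff h = 1 := by
  set Y : ℚ⟦X⟧ := Ξ - 1 with hY
  have hY0 : constantCoeff Y = 0 := by rw [hY, map_sub, hΞ, map_one, sub_self]
  have hYs : HasSubst Y := HasSubst.of_constantCoeff_zero' hY0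
  set g : ℚ⟦X⟧ := (PowerSeries.binomialSeries ℚ (1 / 2 : ℚ)).subst Y with hg
  have hsq : PowerSeries.binomialSeries ℚ (1 / 2 : ℚ) ^ 2 = 1 + X := by
    have h12 : (1 : ℚ) = 1 / 2 + 1 / 2 := by norm_num
    have h := PowerSeries.binomialSeries_nat (R := ℚ) (A := ℚ) 1
    rw [Nat.cast_one, pow_one, h12, PowerSeries.binomialSeries_add] at h
    rw [← h]; ring
  have hg2 : g ^ 2 = 1 + Y := by
    rw [hg, ← coe_substAlgHom hYs, ← map_pow, hsq, map_add, map_one, coe_substAlgHom hYs, subst_X hYs]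
  have hg0 : constantCoeff g = 1 := by
    rw [hg, Literature.RingTheory.FormalGroups.constantCoeff_subst_of_constantCoeff_eq_zero hY0,
      PowerSeries.binomialSeries_constantCoeff]
  exact ⟨g, by rw [hg2, hY]; ring, hg0⟩

/-- In a field, `t² = 1 ⟹ t = 1 ∨ t = −1`. [folklore] -/
theorem eq_one_or_eq_neg_one_of_sq_eq_one {K : Type*} [Field K] {t : K} (ht : t ^ 2 = 1) : t = 1 ∨ t = -1 := by
  have hfac : (t - 1) * (t + 1) = 0 := by linear_combination ht
  rcases mul_eq_zero.mp hfac with h | h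
  · exact Or.inl (by linear_combination h)
  · exact Or.inr (by linear_combination h)

/-- **In the UFD `ℤ₂⟦X⟧`, `B² ∣ A² ⟹ B ∣ A`** (`pow_dvd_pow_iff_dvd`; `ℤ₂` is a PID, so `ℤ₂⟦X⟧` is factorial).
[cite: Washington1997, Thm. 7.3 and §7.1 (ℤ_p⟦T⟧ is a UFD)] -/
theorem dvd_of_sq_dvd_sq {A B : ℤ_[2]⟦X⟧} (h : B ^ 2 ∣ A ^ 2) : B ∣ A :=
  (UniqueFactorizationMonoid.pow_dvd_pow_iff_dvd (by norm_num : (2 : ℕ) ≠ 0)).mp h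

/-! ## §2 `Ξ_T ∈ ℤ₂⟦q⟧` at `4 ∣ N` (the bookkeeping of the tree proof of E-an-47, without the halving) -/

section Integral

open WeierstrassCurve Literature.NumberTheory.EllipticCurves Literature.NumberTheory.EllipticCurves.ModularForms
  Literature.RingTheory.FormalGroups
open Summit.BirchSwinnertonDyer.Rank1Residual.ManinAdditive.CuspidalKummer
open Summit.BirchSwinnertonDyer.BirchSwinnertonDyer.Theorems.ManinLocalTwoThree

/-- **`Ξ_T` is `2`-adically INTEGRAL at `4 ∣ N`**: for a globally minimal `W`, a datum `D` at a level `4 ∣ N`, the germ `z` and any rational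
`2`-division root `e`, `kummerSeries W c e z ∈ ℤ₂⟦q⟧`.  On the `2`-integral model `E♮ = E_{W,1} ⊗ ℤ₂` (`a₁ = a₃ = 0`; additive at `2`, `a_{2m} = 0`)
the scaled germ `D₂ = c·z = exp_{E♮}(c·L)` is `2`-integral and `Ξ_T = X_{E♮}(D₂) − e♮·D₂²`, `e♮ = e + b₂/12 ∈ ℤ₂` — verbatim the steps §5, §C, §F, §G
of `EvenManinKummerSquare_holds`. [cite: SilvermanAEC2009, IV.1 (x(z) ∈ ℤ[a₁,…,a₆]((z))) and IV.5.5] -/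
theorem isPadicInt_kummerSeries (W : WeierstrassCurve ℚ) [W.IsElliptic] [W.IsGloballyMinimal] {N : ℕ} [NeZero N]
    (D : ModularParametrizationData W N) (a : ℕ → ℤ) (ha : ∀ n, (a n : ℂ) = cuspCoeff D.f n) (h4 : 4 ∣ N)
    (e : ℚ) (he : W.twoTorsionPolynomial.toPoly.IsRoot e) (z : ℚ⟦X⟧) (hz : IsParamGerm W D.c a z) :
    IsPadicInt ((kummerSeries W D.c e z).map (algebraMap ℚ ℚ_[2])) := by
  obtain ⟨hz0, hlog⟩ := hz
  have hc0 : D.c ≠ 0 := D.maninConstant_ne_zero_holds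
  -- §5: arithmetic at `2`
  obtain ⟨ha2, hN2⟩ := lFunction_two_eq_zero_of_four_dvd W D.isNewformOf h4
  have hadd := hasAdditiveReductionAt_two_of_lFunction_two_eq_zero W ha2 hN2
  obtain ⟨⟨x, hx⟩, ⟨y, hy⟩⟩ := even_a₁_and_even_a₃_of_hasAdditiveReductionAt_two W hadd
  set M : WeierstrassCurve ℤ := integralModelInt W with hM
  have hWM : M.map (Int.castRingHom ℚ) = W := map_integralModelInt W
  have han : ∀ n, a n = W.LFunction n := fun n => by
    have h := ha n; rw [D.isNewformOf.2 n] at h; exact_mod_cast h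
  -- the `2`-integral short model `E♮ = shortModel W 1` over `ℤ_[2]`
  set κ : ℤ := (x ^ 2 + M.a₂) ^ 2 - 3 * (M.a₄ + 2 * x * y) with hκ
  set μ : ℤ := -2 * (x ^ 2 + M.a₂) ^ 3 + 9 * (x ^ 2 + M.a₂) * (M.a₄ + 2 * x * y) -
    27 * (y ^ 2 + M.a₆) with hμ
  have hWc₄ : W.c₄ = ((16 * κ : ℤ) : ℚ) := by
    rw [← hWM, map_c₄, c₄_eq_of_even_a₁_of_even_a₃ M hx hy]; simp [hκ]
  have hWc₆ : W.c₆ = ((32 * μ : ℤ) : ℚ) := by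
    rw [← hWM, map_c₆, c₆_eq_of_even_a₁_of_even_a₃ M hx hy]; simp [hμ]
  have ha₄ : (shortModel W 1).a₄ = -((κ : ℚ) / 3) := by
    simp only [shortModel, hWc₄]; push_cast; ring
  have ha₆ : (shortModel W 1).a₆ = -((μ : ℚ) / 27) := by
    simp only [shortModel, hWc₆]; push_cast; ring
  have h3 : ‖((3 : ℕ) : ℚ_[2])⁻¹‖ = 1 := padicTwo_norm_inv_natCast_of_odd (by decide)
  have h27 : ‖((27 : ℕ) : ℚ_[2])⁻¹‖ = 1 := padicTwo_norm_inv_natCast_of_odd (by decide)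
  have hrat : ∀ q : ℚ, algebraMap ℚ ℚ_[2] q = (q : ℚ_[2]) := fun q => by rw [eq_ratCast]
  have hA : ‖algebraMap ℚ ℚ_[2] (shortModel W 1).a₄‖ ≤ 1 := by
    rw [hrat, ha₄]; push_cast
    rw [norm_neg, div_eq_mul_inv, norm_mul, show (3 : ℚ_[2]) = ((3 : ℕ) : ℚ_[2]) by norm_cast, h3,
      mul_one]
    exact Padic.norm_int_le_one κ
  have hB : ‖algebraMap ℚ ℚ_[2] (shortModel W 1).a₆‖ ≤ 1 := by
    rw [hrat, ha₆]; push_cast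
    rw [norm_neg, div_eq_mul_inv, norm_mul, show (27 : ℚ_[2]) = ((27 : ℕ) : ℚ_[2]) by norm_cast, h27,
      mul_one]
    exact Padic.norm_int_le_one μ
  set A₀ : ℤ_[2] := ⟨_, hA⟩ with hA₀
  set B₀ : ℤ_[2] := ⟨_, hB⟩ with hB₀
  set V : WeierstrassCurve ℤ_[2] := ⟨0, 0, 0, A₀, B₀⟩ with hVdef
  have hVE : V.map PadicInt.Coe.ringHom = (shortModel W 1).map (algebraMap ℚ ℚ_[2]) := by
    ext <;> simp [hVdef, shortModel, hA₀, hB₀]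
  have hΔ1 : (shortModel W 1).Δ = W.Δ := by
    have hc := W.c_relation
    simp only [shortModel, WeierstrassCurve.Δ, WeierstrassCurve.b₂, WeierstrassCurve.b₄,
      WeierstrassCurve.b₆, WeierstrassCurve.b₈, Int.cast_one, one_pow, one_mul] at hc ⊢
    simp only [WeierstrassCurve.c₄, WeierstrassCurve.c₆, WeierstrassCurve.b₂, WeierstrassCurve.b₄,
      WeierstrassCurve.b₆] at hc ⊢
    linear_combination (1 / 1728 : ℚ) * hc
  haveI hEll : (V.map PadicInt.Coe.ringHom).IsElliptic := by
    rw [hVE]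
    refine ⟨?_⟩
    rw [map_Δ, hΔ1, isUnit_iff_ne_zero]
    exact (map_ne_zero _).mpr ‹W.IsElliptic›.isUnit.ne_zero
  haveI hInt : (V.map PadicInt.Coe.ringHom).IsIntegral ℤ_[2] := V.isIntegral_map_coe
  -- the 2-torsion abscissa `e♮ = e + b₂/12` on `E♮`, a `2`-adic integer
  set eQ : ℚ := shortRoot W 1 e with heQ
  set e₂ : ℚ_[2] := algebraMap ℚ ℚ_[2] eQ with he₂
  have heroot : eQ ^ 3 + (shortModel W 1).a₂ * eQ ^ 2 + (shortModel W 1).a₄ * eQ +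
      (shortModel W 1).a₆ = 0 := shortRoot_one_isRoot W he
  have ha₂0 : (shortModel W 1).a₂ = 0 := rfl
  have heroot₂ : e₂ ^ 3 + (V.a₂ : ℚ_[2]) * e₂ ^ 2 + (V.a₄ : ℚ_[2]) * e₂ + (V.a₆ : ℚ_[2]) = 0 := by
    have h := congrArg (algebraMap ℚ ℚ_[2]) heroot
    simp only [map_add, map_mul, map_pow, map_zero, ha₂0, zero_mul, add_zero] at h
    have h2 : (V.a₂ : ℚ_[2]) = 0 := by simp [hVdef]
    rw [h2, zero_mul, add_zero]
    exact h
  have henorm : ‖e₂‖ ≤ 1 := by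
    refine padic_norm_le_one_of_cubic_root (A := (V.a₄ : ℚ_[2])) (B := (V.a₆ : ℚ_[2]))
      (PadicInt.norm_le_one _) (PadicInt.norm_le_one _) ?_
    have h := heroot₂
    simp only [hVdef, PadicInt.coe_zero, zero_mul, add_zero] at h ⊢
    linear_combination h
  -- §C: the germ, read on `E♮ ⊗ ℚ₂`
  set ι : ℚ⟦X⟧ →+* ℚ_[2]⟦X⟧ := PowerSeries.map (algebraMap ℚ ℚ_[2]) with hι
  set z₂ : ℚ_[2]⟦X⟧ := ι z with hz₂
  set L₂ : ℚ_[2]⟦X⟧ := ι (lSeriesLog a) with hL₂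
  set D₂ : ℚ_[2]⟦X⟧ := C ((D.c : ℚ) : ℚ_[2]) * z₂ with hD₂
  have hcz0 : constantCoeff (C (D.c : ℚ) * z) = 0 := by rw [map_mul, hz0, mul_zero]
  have hlog1 : (shortModel W 1).formalLog.subst (C (D.c : ℚ) * z) = C (D.c : ℚ) * lSeriesLog a := by
    have h := formalLog_shortModel_subst W hc0 hz0
    rw [hlog] at h
    have hcc : (C (D.c : ℚ) : ℚ⟦X⟧) * C (D.c : ℚ)⁻¹ = 1 := by
      rw [← map_mul, mul_inv_cancel₀ (Int.cast_ne_zero.mpr hc0), map_one]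
    calc (shortModel W 1).formalLog.subst (C (D.c : ℚ) * z)
        = C (D.c : ℚ) * C (D.c : ℚ)⁻¹ * (shortModel W 1).formalLog.subst (C (D.c : ℚ) * z) := by
          rw [hcc, one_mul]
      _ = C (D.c : ℚ) * lSeriesLog a := by rw [mul_assoc, ← h]
  have hz₂0 : constantCoeff z₂ = 0 := by
    rw [hz₂, hι, ← coeff_zero_eq_constantCoeff, coeff_map, coeff_zero_eq_constantCoeff, hz0, map_zero]
  have hD₂0 : constantCoeff D₂ = 0 := by rw [hD₂, map_mul, hz₂0, mul_zero]
  have hL₂0 : constantCoeff L₂ = 0 := by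
    rw [hL₂, hι, ← coeff_zero_eq_constantCoeff, coeff_map, lSeriesLog, coeff_mk]; simp
  have hlog2 : (V.map PadicInt.Coe.ringHom).formalLog.subst D₂ = C ((D.c : ℚ) : ℚ_[2]) * L₂ := by
    have h := congrArg ι hlog1
    rw [hι, map_subst_apply (HasSubst.of_constantCoeff_zero' hcz0), map_formalLog, ← hVE, map_mul,
      map_C, map_mul, map_C, hrat] at h
    exact h
  -- §D': `D₂ = [1](exp_{E♮}(c·L))` is `2`-integral (no halving)
  have hcc' : ((D.c : ℚ) : ℚ_[2]) = (1 : ℕ) * ((D.c : ℚ) : ℚ_[2]) := by push_cast; ring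
  set t : ℚ_[2]⟦X⟧ := (V.map PadicInt.Coe.ringHom).formalExp.subst (C ((D.c : ℚ) : ℚ_[2]) * L₂) with htdef
  have hDt : D₂ = ((V.map PadicInt.Coe.ringHom).formalMul 1).subst t :=
    eq_formalMul_subst_formalExp_of_formalLog_subst' (V.map PadicInt.Coe.ringHom) 1 hD₂0 hL₂0 hcc' hlog2
  have hu0 : constantCoeff (C ((D.c : ℚ) : ℚ_[2]) * L₂) = 0 := by rw [map_mul, hL₂0, mul_zero]
  have ht0 : constantCoeff t = 0 := by
    rw [htdef, Literature.RingTheory.FormalGroups.constantCoeff_subst_of_constantCoeff_eq_zero hu0,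
      constantCoeff_formalExp]
  have hL₂int : IsPadicInt L₂ := by
    rw [isPadicInt_iff_coeff]
    intro n
    rw [hL₂, hι, coeff_map, lSeriesLog, coeff_mk, hrat]
    by_cases hn0 : n = 0
    · subst hn0; simp
    rcases Nat.even_or_odd n with hev | hodd
    · rw [han n, lFunction_eq_zero_of_even W ha2 hN2 hn0 (even_iff_two_dvd.mp hev)]
      simp
    · push_cast
      rw [div_eq_mul_inv, norm_mul, padicTwo_norm_inv_natCast_of_odd hodd, mul_one]
      exact Padic.norm_int_le_one _
  have hcint : IsPadicInt (C ((D.c : ℚ) : ℚ_[2]) : ℚ_[2]⟦X⟧) := by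
    rw [Rat.cast_intCast]
    exact IsPadicInt.powerSeries_C (Padic.norm_int_le_one _)
  have htint : IsPadicInt t :=
    (isPadicInt_formalExp_of_a₁_a₃_two V rfl rfl).powerSeries_subst (hcint.mul hL₂int)
      (HasSubst.of_constantCoeff_zero' hu0)
  have hDint : IsPadicInt D₂ := by
    rw [hDt]
    exact (isPadicInt_formalMul (V.map PadicInt.Coe.ringHom) 1).powerSeries_subst htint
      (HasSubst.of_constantCoeff_zero' ht0)
  -- §F: the Kummer series read on `E♮ ⊗ ℚ₂`
  have hΞ : ι (kummerSeries W D.c e z) =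
      (V.map PadicInt.Coe.ringHom).formalXMulSq.subst D₂ - C e₂ * D₂ ^ 2 := by
    have h1 : ι ((shortModel W D.c).formalXMulSq.subst z) =
        (V.map PadicInt.Coe.ringHom).formalXMulSq.subst D₂ := by
      rw [formalXMulSq_shortModel_subst W hc0 hz0, hι,
        map_subst_apply (HasSubst.of_constantCoeff_zero' hcz0), map_formalXMulSq, ← hVE, map_mul, map_C,
        hrat]
    have h2 : ι (shortRoot W D.c e • z ^ 2) = C e₂ * D₂ ^ 2 := by
      have hsc : algebraMap ℚ ℚ_[2] (shortRoot W D.c e) = e₂ * ((D.c : ℚ) : ℚ_[2]) ^ 2 := by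
        rw [he₂, heQ, hrat, hrat]
        simp only [shortRoot]
        push_cast
        ring
      rw [smul_eq_C_mul, map_mul, map_pow, hι, map_C, hsc, hD₂]
      simp only [map_mul, map_pow]
      ring
    rw [kummerSeries, map_sub, h1, h2]
  -- §G: integrality
  have hXint : IsPadicInt ((V.map PadicInt.Coe.ringHom).formalXMulSq.subst D₂) :=
    (isPadicInt_formalXMulSq (V.map PadicInt.Coe.ringHom)).powerSeries_subst hDint
      (HasSubst.of_constantCoeff_zero' hD₂0)
  have he₂int : IsPadicInt (C e₂ : ℚ_[2]⟦X⟧) := IsPadicInt.powerSeries_C henorm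
  change IsPadicInt (ι (kummerSeries W D.c e z))
  rw [hΞ]
  exact hXint.sub (he₂int.mul (hDint.pow 2))

end Integral

/-! ## §3 (BI₂): `2 ∣ c` ⟹ the normalised square root of `Ξ_T` is `2`-adically integral -/

section Main

open WeierstrassCurve Literature.NumberTheory.EllipticCurves Literature.NumberTheory.EllipticCurves.ModularForms
  Literature.RingTheory.FormalGroups
open Summit.BirchSwinnertonDyer.Rank1Residual.ManinAdditive.CuspidalKummer
open Summit.BirchSwinnertonDyer.BirchSwinnertonDyer.Theorems.ManinLocalTwoThree

/-- **Every normalised square root of `Ξ_T` is `2`-adically integral when `2 ∣ c`** (`4 ∣ N`): for `h ∈ ℚ⟦q⟧` with `h² = Ξ_T`, `h(0) = 1`, every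
coefficient `hₙ` has odd denominator.  E-an-47 (`Ξ_T·B² = A²` over `ℤ₂⟦q⟧`) + §2 (`Ξ_T ∈ ℤ₂⟦q⟧`) + unique factorisation (`B ∣ A`) + uniqueness of
square roots. [cite: Washington1997, Thm. 7.3 and §7.1 (ℤ_p⟦T⟧ is a UFD — here Mathlib)] [cite: SilvermanAEC2009, X.1 Prop. 1.4 (shape, through E-an-47)] -/
theorem kummerSqRoot_unique_twoAdicallyIntegral (W : WeierstrassCurve ℚ) [W.IsElliptic] [W.IsGloballyMinimal] {N : ℕ} [NeZero N]
    (D : ModularParametrizationData W N) (a : ℕ → ℤ) (ha : ∀ n, (a n : ℂ) = cuspCoeff D.f n) (h4 : 4 ∣ N)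
    (e : ℚ) (he : W.twoTorsionPolynomial.toPoly.IsRoot e) (z : ℚ⟦X⟧) (hz : IsParamGerm W D.c a z) (h2c : (2 : ℤ) ∣ D.c)
    (h : ℚ⟦X⟧) (hh2 : h ^ 2 = kummerSeries W D.c e z) (hh0 : constantCoeff h = 1) :
    ∀ n : ℕ, ¬ (2 ∣ (coeff n h).den) := by
  set Ξ : ℚ⟦X⟧ := kummerSeries W D.c e z with hΞdef
  have hΞ0 : constantCoeff Ξ = 1 := SquareRootDescent.constantCoeff_kummerSeries W D.c e hz
  -- E-an-47: `Ξ·B² = A²` over `ℤ₂⟦q⟧`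
  obtain ⟨A, B, hB0, hAB⟩ := EvenManinKummerSquare_holds W D a ha h4 e he z hz h2c
  rw [Subsingleton.elim (Rat.castHom ℚ_[2]) (algebraMap ℚ ℚ_[2])] at hAB
  -- `Ξ ∈ ℤ₂⟦q⟧`
  have hK := isPadicInt_kummerSeries W D a ha h4 e he z hz
  set ι : ℚ⟦X⟧ →+* ℚ_[2]⟦X⟧ := PowerSeries.map (algebraMap ℚ ℚ_[2]) with hι
  set κ : ℤ_[2]⟦X⟧ →+* ℚ_[2]⟦X⟧ := PowerSeries.map (PadicInt.Coe.ringHom (p := 2)) with hκ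
  have hκinj : Function.Injective κ := PowerSeries.map_injective _ Subtype.val_injective
  have hκint : ∀ G : ℤ_[2]⟦X⟧, IsPadicInt (κ G) := fun G ↦ isPadicInt_iff_exists_powerSeries_map.mpr ⟨G, rfl⟩
  change ι Ξ * κ B ^ 2 = κ A ^ 2 at hAB
  change IsPadicInt (ι Ξ) at hK
  obtain ⟨G, hG⟩ := isPadicInt_iff_exists_powerSeries_map.mp hK
  -- in the UFD `ℤ₂⟦q⟧`: `A² = G·B²`, so `B ∣ A`
  have hR : A ^ 2 = G * B ^ 2 := by
    apply hκinj
    have hG' : κ G = ι Ξ := hG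
    rw [map_pow, map_mul, hG', map_pow, ← hAB]
  obtain ⟨g, hg⟩ : B ∣ A := dvd_of_sq_dvd_sq ⟨G, by rw [hR, mul_comm]⟩
  -- `x = κ g` is a square root of `Ξ` over `ℚ₂` with `x(0) = ±1`
  have hB₂0 : κ B ≠ 0 := fun h0 ↦ hB0 (hκinj (by rw [h0, map_zero]))
  have hBx : κ B * κ g = κ A := by rw [← map_mul, hg]
  have hx2 : κ g ^ 2 = ι Ξ := by
    have e2 : κ B ^ 2 * κ g ^ 2 = κ B ^ 2 * ι Ξ := by rw [← mul_pow, hBx, ← hAB, mul_comm]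
    exact mul_left_cancel₀ (pow_ne_zero 2 hB₂0) e2
  have hιΞ0 : constantCoeff (ι Ξ) = 1 := by
    rw [hι, ← coeff_zero_eq_constantCoeff, coeff_map, coeff_zero_eq_constantCoeff, hΞ0, map_one]
  have hx0sq : constantCoeff (κ g) ^ 2 = 1 := by rw [← map_pow, hx2, hιΞ0]
  -- normalise the sign: `x' = ±κ g` with `x'(0) = 1`
  obtain ⟨ε, hε, hx'0⟩ : ∃ ε : ℤ_[2]⟦X⟧, (ε = 1 ∨ ε = -1) ∧ constantCoeff (κ (ε * g)) = 1 := by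
    rcases eq_one_or_eq_neg_one_of_sq_eq_one hx0sq with h1 | h1
    · exact ⟨1, Or.inl rfl, by rw [one_mul, h1]⟩
    · exact ⟨-1, Or.inr rfl, by rw [neg_one_mul, map_neg, map_neg, h1, neg_neg]⟩
  have hx'2 : κ (ε * g) ^ 2 = ι Ξ := by
    rcases hε with rfl | rfl
    · rw [one_mul, hx2]
    · rw [neg_one_mul, map_neg, neg_sq, hx2]
  have hιh2 : (ι h) ^ 2 = ι Ξ := by rw [← map_pow, hh2]
  have hιh0 : constantCoeff (ι h) = 1 := by
    rw [hι, ← coeff_zero_eq_constantCoeff, coeff_map, coeff_zero_eq_constantCoeff, hh0, map_one]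
  have hxh : ι h = κ (ε * g) :=
    sqRoot_unique (by norm_num) (hιh2.trans hx'2.symm) (by rw [hιh0, hx'0]) (by rw [hιh0]; norm_num)
  -- hence `h ∈ ℤ₂⟦q⟧`
  have hint : IsPadicInt (ι h) := by rw [hxh]; exact hκint _
  intro n
  refine not_dvd_den_of_norm_ratCast_le_one ?_
  have hn := (isPadicInt_iff_coeff.mp hint) n
  rw [hι, coeff_map, eq_ratCast] at hn
  exact hn

/-- **(BI₂) — the node.**  For a globally minimal `W`, an `X₀(N)`-datum `D` with integral newform coefficients `aₙ`, `4 ∣ N`, a rational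
`2`-division root `e` and the germ `z`: if `2 ∣ c` then `Ξ_T = kummerSeries W c e z` has a formal square root `h ∈ ℚ⟦q⟧` with `h(0) = 1` all of
whose coefficients are `2`-adic integers.  The ℓ = 2 port of p3's (BI) `kummerCubeRoot_threeAdicallyBounded` (with `K = 0`).  Nothing about the
witness law, CDT, C2, Manin's conjecture or BSD is proved by this; no optimal curve with `2 ∣ c` at `4 ∣ N` is known.
[cite: Washington1997, Thm. 7.3 and §7.1] [cite: SilvermanAEC2009, X.1 Prop. 1.4 (shape, through E-an-47)] -/
theorem kummerSqRoot_twoAdicallyIntegral (W : WeierstrassCurve ℚ) [W.IsElliptic] [W.IsGloballyMinimal] {N : ℕ} [NeZero N]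
    (D : ModularParametrizationData W N) (a : ℕ → ℤ) (ha : ∀ n, (a n : ℂ) = cuspCoeff D.f n) (h4 : 4 ∣ N)
    (e : ℚ) (he : W.twoTorsionPolynomial.toPoly.IsRoot e) (z : ℚ⟦X⟧) (hz : IsParamGerm W D.c a z) (h2c : (2 : ℤ) ∣ D.c) :
    ∃ h : ℚ⟦X⟧, h ^ 2 = kummerSeries W D.c e z ∧ constantCoeff h = 1 ∧ ∀ n : ℕ, ¬ (2 ∣ (coeff n h).den) := by
  obtain ⟨h, hh2, hh0⟩ := exists_sqRoot_of_constantCoeff_eq_one _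
    (SquareRootDescent.constantCoeff_kummerSeries W D.c e hz)
  exact ⟨h, hh2, hh0, kummerSqRoot_unique_twoAdicallyIntegral W D a ha h4 e he z hz h2c h hh2 hh0⟩

/-- **(BI₂), bounded form** (the shape of an's `IsThreeAdicallyBounded` at the prime `2`: `∃ K, ∀ n, 2 ∤ den(2^K·hₙ)`; here `K = 0`).
[cite: Washington1997, Thm. 7.3 and §7.1] -/
theorem kummerSqRoot_twoAdicallyBounded (W : WeierstrassCurve ℚ) [W.IsElliptic] [W.IsGloballyMinimal] {N : ℕ} [NeZero N]
    (D : ModularParametrizationData W N) (a : ℕ → ℤ) (ha : ∀ n, (a n : ℂ) = cuspCoeff D.f n) (h4 : 4 ∣ N)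
    (e : ℚ) (he : W.twoTorsionPolynomial.toPoly.IsRoot e) (z : ℚ⟦X⟧) (hz : IsParamGerm W D.c a z) (h2c : (2 : ℤ) ∣ D.c) :
    ∃ h : ℚ⟦X⟧, h ^ 2 = kummerSeries W D.c e z ∧ constantCoeff h = 1 ∧
      ∃ K : ℕ, ∀ n : ℕ, ¬ (2 ∣ ((2 : ℚ) ^ K * coeff n h).den) := by
  obtain ⟨h, hh2, hh0, hint⟩ := kummerSqRoot_twoAdicallyIntegral W D a ha h4 e he z hz h2c
  exact ⟨h, hh2, hh0, 0, fun n ↦ by rw [pow_zero, one_mul]; exact hint n⟩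

end Main

end Summit.BirchSwinnertonDyer.BirchSwinnertonDyer.Theorems.ManinLocalTwoThree.KummerSqRootBounded

end
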